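import Mathlib.Analysis.SpecialFunctions.Integrals.Basic
import HarnessLib

/-!
# R-H ROUND 4, HUMAN ORDER (I-1) «EVO ON THE DUALS» — the 3/2-LICENCE identity behind the universal D1 dual law (PROOF-ONLY, 0 definitions)

abc-iut cell, rung LADDER-ABC:A2.RESCUE.H; seat abc-iut-evo-2 (ENGINE B, KEY I1-EVO-DUALS-B; memo
`plan/rescue/R-H/ROUND4/I1-EVO-DUALS-B-evo-2.md`). In the D1 cell currency the certified allowance of label `j` at a bad place is, to leading
order, LINEAR in the label (`j·δ_w + (j+1)·G_w + residue`) while print's demand is QUADRATIC (`(j²−1)·m_q`); with `A := (δ_w + G_w)/m_q`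
the licensed surplus below `A` finances the deficit above `A`. The continuum bookkeeping is the elementary identity proved here:
`∫₀^A (A·x − x²) dx = A³/6` (surplus), `∫_A^J (x² − A·x) dx = J³/3 − A·J²/2 + A³/6` (deficit), and for `0 < A ≤ J` the two are equal iff
`J = (3/2)·A` — the within-place self-financing cut sits at 3/2 × the licence. On the beds of record the LP optimum's cut satisfies
`3/2·A_w + 0.42 ≤ JMAX_w ≤ 3/2·A_w + 1.37` at all 467 budget-bound places (engine B, kit j292647; computed ≠ proved — a table, not this file).
HONEST FRAMING: first-year calculus over ℝ; nothing here asserts that abc is proved or refuted, or that [IUTchIII] Cor. 3.12 / [IUTchIV]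
Thm. 1.10 holds or fails at any datum, or takes a side on any author; typed ≠ proved; a law fitted ≠ a theorem. [folklore]
-/

namespace Summit.ABC.Theorems.IUTThetaPilot.RHThreeHalves

open intervalIntegral

/-- **Continuum surplus below the licence.** `∫₀^A (A·x − x²) dx = A³/6`. [folklore] -/
theorem surplus_eq (A : ℝ) : ∫ x in (0 : ℝ)..A, (A * x - x ^ 2) = A ^ 3 / 6 := by
  rw [integral_sub, intervalIntegral.integral_const_mul, integral_id, integral_pow]
  · ring
  · exact (continuous_const.mul continuous_id).intervalIntegrable _ _
  · exact (continuous_pow 2).intervalIntegrable _ _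

/-- **Continuum deficit above the licence.** `∫_A^J (x² − A·x) dx = J³/3 − A·J²/2 + A³/6`. [folklore] -/
theorem deficit_eq (A J : ℝ) : ∫ x in A..J, (x ^ 2 - A * x) = J ^ 3 / 3 - A * J ^ 2 / 2 + A ^ 3 / 6 := by
  rw [integral_sub, intervalIntegral.integral_const_mul, integral_id, integral_pow]
  · ring
  · exact (continuous_pow 2).intervalIntegrable _ _
  · exact (continuous_const.mul continuous_id).intervalIntegrable _ _

/-- **The 3/2-licence law.** For a licence `A > 0` and a cut `J ≥ A`, the deficit financed up to `J` equals the surplus below `A`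
iff `J = (3/2)·A`. [folklore] -/
theorem deficit_eq_surplus_iff {A J : ℝ} (hA : 0 < A) (hJ : A ≤ J) :
    ∫ x in A..J, (x ^ 2 - A * x) = ∫ x in (0 : ℝ)..A, (A * x - x ^ 2) ↔ J = 3 / 2 * A := by
  rw [deficit_eq, surplus_eq]
  have hJ0 : 0 < J := lt_of_lt_of_le hA hJ
  constructor
  · intro h
    have h2 : J ^ 2 * (2 * J - 3 * A) = 0 := by linear_combination 6 * h
    rcases mul_eq_zero.mp h2 with h3 | h3
    · exact absurd (pow_eq_zero_iff two_ne_zero |>.mp h3) hJ0.ne'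
    · linarith
  · intro h
    subst h
    ring

/-- **At the 3/2 cut the books balance exactly**: `∫_A^{3A/2} (x² − A·x) dx = ∫₀^A (A·x − x²) dx` for every real `A`. [folklore] -/
theorem deficit_threeHalves_eq_surplus (A : ℝ) :
    ∫ x in A..(3 / 2 * A), (x ^ 2 - A * x) = ∫ x in (0 : ℝ)..A, (A * x - x ^ 2) := by
  rw [deficit_eq, surplus_eq]; ring

/-- **Below 3/2 the cut is self-financing, above it is not** (monotone form used by the bed evaluator): for `0 < A ≤ J`,
deficit `≤` surplus iff `J ≤ (3/2)·A`. [folklore] -/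
theorem deficit_le_surplus_iff {A J : ℝ} (hA : 0 < A) (hJ : A ≤ J) :
    ∫ x in A..J, (x ^ 2 - A * x) ≤ ∫ x in (0 : ℝ)..A, (A * x - x ^ 2) ↔ J ≤ 3 / 2 * A := by
  rw [deficit_eq, surplus_eq]
  have hJ0 : 0 < J := lt_of_lt_of_le hA hJ
  have hJ2 : 0 < J ^ 2 := by positivity
  constructor
  · intro h
    by_contra hc
    have hc' : 3 / 2 * A < J := lt_of_not_ge hc
    have : 0 < J ^ 2 * (2 * J - 3 * A) := mul_pos hJ2 (by linarith)
    nlinarith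
  · intro h
    have : J ^ 2 * (2 * J - 3 * A) ≤ 0 := mul_nonpos_of_nonneg_of_nonpos hJ2.le (by linarith)
    nlinarith

end Summit.ABC.Theorems.IUTThetaPilot.RHThreeHalves
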